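import Summits.Ventures.CertifiedManyBodySolver.Downfold.EmeryFermiScaleAxis
import HarnessLib

/-!
# The velocity-matched one-band hopping AT THE ANTINODE (zone-face point) of a σ contour in closed form:
# `t_face(ε) = scaleT(1, yFace; ε) = fsT·(4fsD + 16fsN)/(4(t_pd²·faceN + faceR))`

Venture CertifiedManyBodySolver, cell `pub/hubbard-downfold` (stage S1; INFLATION-RULES-3to1-B §B.74 (b′) — the antinodal end of the SCALE leg), seat hubbard-downfold-mod-4 (technique B, g29);
namespace `Summit.Ventures.CertifiedManyBodySolver.Downfold.Emery`. Sequel of `EmeryOrbitalWeightFace` (`faceN`, `faceR`, `faceDen_mul_dcharCubic`: `F·ε·∂_ε charCubic(1, yFace) = 4ε(t_pd²faceN + faceR)`,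
`F = 4fsD + 16fsN`) and `EmeryFermiScaleNode`/`EmeryFermiScaleAxis` (the node and axis ends). Everything PROVED (0 sorry). WHAT THIS IS NOT: a statement about any material; `U = 0` one-body
kinematics; the antinodal scale LEVER (monotonicity in ε_F) is NOT proved here in general — on the face window it is numerically strictly decreasing under `t_ppΔ ≤ 4t_pd²` (seat-side
exact-rational search) and census-certified on 33/33 rows, but it has no low-degree Handelman certificate in the natural generators (kit j339274/291/302 infeasible); at `t_pp′ = 0` a
degree-2 certificate exists (kit j339358) — see the sequel if landed.

* `scaleFaceN = fsT·(4fsD + 16fsN)`, `scaleFaceD = 4(t_pd²·faceN + faceR)` (`> 0` on the face window, `scaleFaceD_pos`), **`scaleT_face_eq`**: `scaleT(1, yFace(ε); ε) = scaleFaceN/scaleFaceD`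
  (`ε > 0`, face window lower edge `faceG ≥ 0`, `fsD > 0`, `0 ≤ t_pp′ ≤ t_pp`); `scaleT_face_pos`.

Sources: three-band model [HybertsenSchluterChristensen1989, Eq. (1)]; [AndersenEtAl1995, §6]; [folklore] algebra.
-/

noncomputable section

namespace Summit.Ventures.CertifiedManyBodySolver.Downfold.Emery

open Real Set

/-- Numerator of the antinodal scale: `scaleFaceN = fsT·(4fsD + 16fsN)`. [folklore] -/
def scaleFaceN (Δ tpd tpp c ε : ℝ) : ℝ := fsT Δ tpd tpp c ε * (4 * fsD Δ tpd c ε + 16 * fsN tpd tpp c ε)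

/-- Denominator of the antinodal scale: `scaleFaceD = 4(t_pd²·faceN + faceR)`. [folklore] -/
def scaleFaceD (Δ tpd tpp c ε : ℝ) : ℝ := 4 * (tpd ^ 2 * faceN Δ tpp c ε + faceR Δ tpd tpp c ε)

/-- `scaleFaceD > 0` on the face window (`Δ + ε > 0`, `0 ≤ t_pp′ ≤ t_pp`, `ε > 0`, `t_pp′ε < t_pd²`, `faceG ≥ 0`). [folklore] -/
theorem scaleFaceD_pos {Δ tpd tpp c ε : ℝ} (hE : 0 < Δ + ε) (hc : 0 ≤ c) (hct : c ≤ tpp) (hε : 0 < ε) (hm : c * ε < tpd ^ 2) (hG : 0 ≤ faceG Δ tpd c ε) :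
    0 < scaleFaceD Δ tpd tpp c ε := by
  unfold scaleFaceD
  have hR := faceR_pos hE hc hct hε hm hG
  have hN := faceN_pos (Δ := Δ) (ε := ε) hE (by linarith : 0 ≤ tpp + c)
  positivity

/-- **THE ANTINODAL SCALE IN CLOSED FORM**: `scaleT(1, yFace(ε); ε) = scaleFaceN/scaleFaceD` on the face window. [folklore] -/
theorem scaleT_face_eq {Δ tpd tpp c ε : ℝ} (hE : 0 < Δ + ε) (hc : 0 ≤ c) (hct : c ≤ tpp) (hε : 0 < ε) (hm : c * ε < tpd ^ 2) (hG : 0 ≤ faceG Δ tpd c ε) :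
    scaleT Δ tpd tpp c 1 (yFace Δ tpd tpp c ε) ε = scaleFaceN Δ tpd tpp c ε / scaleFaceD Δ tpd tpp c ε := by
  have hD : 0 < fsD Δ tpd c ε := fsD_pos hE hm
  have hF : 0 < 4 * fsD Δ tpd c ε + 16 * fsN tpd tpp c ε := by have := fsN_nonneg (tpd := tpd) hc hct hε.le; positivity
  have hW := scaleFaceD_pos hE hc hct hε hm hG
  have h3 := faceDen_mul_dcharCubic (Δ := Δ) (tpd := tpd) (tpp := tpp) (c := c) (ε := ε) hF.ne'
  have hdc : dcharCubic Δ tpd tpp c 1 (yFace Δ tpd tpp c ε) ε = scaleFaceD Δ tpd tpp c ε / (4 * fsD Δ tpd c ε + 16 * fsN tpd tpp c ε) := by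
    rw [eq_div_iff hF.ne', scaleFaceD]
    have := mul_left_cancel₀ hε.ne' (show ε * ((4 * fsD Δ tpd c ε + 16 * fsN tpd tpp c ε) * dcharCubic Δ tpd tpp c 1 (yFace Δ tpd tpp c ε) ε) =
        ε * (4 * (tpd ^ 2 * faceN Δ tpp c ε + faceR Δ tpd tpp c ε)) by linear_combination h3)
    linarith [this]
  unfold scaleT
  rw [hdc, div_div_eq_mul_div, div_eq_div_iff hW.ne' hW.ne', scaleFaceN]

/-- The antinodal scale is positive on the face window. [folklore] -/
theorem scaleT_face_pos {Δ tpd tpp c ε : ℝ} (hE : 0 < Δ + ε) (hc : 0 ≤ c) (hct : c ≤ tpp) (hε : 0 < ε) (hm : c * ε < tpd ^ 2) (hG : 0 ≤ faceG Δ tpd c ε) :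
    0 < scaleT Δ tpd tpp c 1 (yFace Δ tpd tpp c ε) ε := by
  rw [scaleT_face_eq hE hc hct hε hm hG]
  have hW := scaleFaceD_pos hE hc hct hε hm hG
  have hT : 0 < fsT Δ tpd tpp c ε := by
    unfold fsT; have := fsD_pos hE hm; have := fsN_nonneg (tpd := tpd) hc hct hε.le; positivity
  have hF : 0 < 4 * fsD Δ tpd c ε + 16 * fsN tpd tpp c ε := by have := fsD_pos hE hm; have := fsN_nonneg (tpd := tpd) hc hct hε.le; positivity
  unfold scaleFaceN
  positivity

end Summit.Ventures.CertifiedManyBodySolver.Downfold.Emery
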